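import Summits.HodgeConjecture.HodgeConjecture.Theorems.HeckePrymWeilHeckePrymAnchorsOfTwoFacts
import Summits.HodgeConjecture.HodgeConjecture.Theorems.HeckePrymWeilHeckePrymAnchorsIsogenyTransfer
import Summits.HodgeConjecture.HodgeConjecture.Theorems.HeckePrymWeilHeckePrymAnchorsSeedSurface
import Summits.HodgeConjecture.HodgeConjecture.Theorems.HeckePrymWeilHeckePrymAnchorsAimedStep
import Summits.HodgeConjecture.HodgeConjecture.Theorems.HeckePrymWeilHeckePrymAnchorsUnbalancedZero
import Literature.AlgebraicGeometry.HodgeTheory.InvariantClassesFromTotalSpaceHolds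
import Literature.AlgebraicGeometry.HodgeTheory.WeilFamilyReachOfSystem
import Literature.AlgebraicGeometry.HodgeTheory.WeilClassesDescendingHolds
import Literature.AlgebraicGeometry.HodgeTheory.WeilClassesRationalPlane
import Literature.AlgebraicGeometry.HodgeTheory.HyperbolicWeilTypeBalanced
import Literature.AlgebraicGeometry.Motives.AbelianVarietyIsogenyPairFlip
import HarnessLib

/-!
# `HeckePrymAnchors` from the summit's shared Weil-family fact `weilFamilyReach_hyperbolic` (item stmt-HodgeConjecture-14496, route HeckePrymWeil)

Line `Sketch`, continuation lead c11 (2026-08-16). CONDITIONAL closure of the crux on ONE named fact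
of the tree, the SHARED one:

* `heckePrymAnchors_of_weilFamilyReach : weilFamilyReach_hyperbolic → HeckePrymAnchors`;
* `heckePrymAnchors_of_weilSystem : weilFamily_hyperbolic_weilSystem_reach → HeckePrymAnchors` — the
  same from the family-first sibling fact (`HodgeTheory/WeilFamilyReachSystem`), through the tree's
  `weilFamilyReach_core_of_weilSystem`;
both being `heckePrymAnchors_of_reachCore` applied to the COMMON CORE of the two facts (family through
the hyperbolic `P`, flat Weil section of Hodge type `(n,n)` everywhere, reached fibre `K`-isogenous to the
hyperbolic target, isogeny FROM the fibre; no polarization class, no non-vanishing), which is all the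
line consumes (`reachCore_of_weilFamilyReach` projects `weilFamilyReach_hyperbolic` onto it, flipping the
isogeny pair with `AbelianVariety.exists_isogenyPair_flip`).

`HodgeTheory.weilFamilyReach_hyperbolic` (WFR; `HodgeTheory/WeilFamilyReach`) is Deligne's polarized
Weil family through a HYPERBOLIC abelian `2k`-fold `(P, ψ₀, h_K)` with its flat Weil section and the
REACH of every hyperbolic target of the same `(2k, p)` up to a `K`-linear isogeny
([Deligne1982HodgeCycles], proof of Thm. 4.8 with Prop. 4.4; [vanGeemen1994HodgeAV] 5.2–5.11;
[MumfordFogartyKirwan1994] Thm. 7.9–7.10) — already the residual fact of the line of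
stmt-HodgeConjecture-1333 (`Theorems/PadicSemiregularLiftHodgeAbelianVarietiesStubClosingFacts`) and of
`Theorems/HeckePrymWeilWeilTwelvefoldsSqrtMinus7IsotypicReach`, and reduced in the tree to the bare
level-`n` construction (`HodgeTheory/WeilFamilyReachOf{System,Monodromy,Construction,LevelConstruction}`).
Up to v16 this line hung instead on the bespoke fact M3 = `deligne1982_weilFamily_levelStructure`
(family through `A × (E × E)` with a TENSOR fibre; closure `heckePrymAnchors_of_levelStructure`,
which stays valid). What makes the switch possible is the tree's PROVED aiming lemma
`exists_weilTypeSurface_prod_isHyperbolicWeilType_all_holds` (Markman arXiv:2509.23403 §11.5 Step 2,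
van Geemen LNM 1594 5.2–5.4, via `meyer_holds`): for every BALANCED Weil-type `(A, φ)` there is a
CM-square Weil surface `B` and a weighted Segre class making `A × B` of hyperbolic Weil type — the
planner's original "B must be the aimed `B_δ`".

Proof of the closure. Given `(A, φ)` (`dim A = 2n`, `φ² = -p`):
* if `A` is BALANCED (`dim (V₊ ∩ H^{1,0}) = n`), it carries a non-zero rational `(n,n)` Weil class
  (`exists_isRationalClass_hodgeType_of_weilType'`, `stub_upgrade`), so the aiming lemma gives the
  companion surface `B` (guard: `u₊ + u₋`, `guard_of_weilLines`) with `A × B` hyperbolic; for a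
  rational `(k,k)` class `c ≠ 0` of the typed Weil plane of `A × B` (`k = n + 1`), upgraded to the
  strong plane (`stub_upgrade`), WFR with `P := A × B`, `w := c` and the hyperbolic algebraic target
  `T` of `hyperbolicTargets` (chain of aimed products `seedChain`: `stub_seedSurface`,
  `stub_aimedStep`, both landed) yields the family `f : 𝒳 → S`, the flat section `σ` through `c`, of
  Hodge type `(k,k)` everywhere, and a fibre `A' ≅ 𝒳_{s₁}` `K`-isogenous to `T` where `σ(s₁) ≠ 0`
  lies in the Weil plane; the DISCHARGED Deligne-1968 engine
  (`stub_globalClassOfSection_of_leray deligne1968_invariantClass_fromTotalSpace_holds`) globalises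
  `σ` to ONE class `W` of the total space, rational on every fibre (`stub_rationalAlongSection`);
  `W|_{𝒳_{s₁}}` is algebraic because the Weil plane of `T` is, across the flipped isogeny pair
  (`AbelianVariety.exists_isogenyPair_flip`, `stub_isogenyTransfer`) and the chart (`owf_isoTransport`);
* if `A` is NOT balanced, take the companion surface of `stub_weilSurface`: every rational `(k,k)`
  class of the typed Weil plane of `A × B` is `0` (`stub_unbalancedZero`, landed), anchored by the
  constant family (`owf_anchored_zero`).
No definition, no `sorry`; the only hypothesis is the named fact WFR.
-/


noncomputable section

-- every declaration of this problem lives in `Summit.HodgeConjecture.HodgeConjecture.…` (summit = sub-problem)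
set_option linter.dupNamespace false

open CategoryTheory AlgebraicGeometry Limits MonoidalCategory CartesianMonoidalCategory

namespace Summit.HodgeConjecture.HodgeConjecture.Theorems.HeckePrymWeilLine

open Literature.AlgebraicGeometry Literature.AlgebraicGeometry.Motives Literature.AlgebraicGeometry.HodgeTheory
open Literature.AlgebraicTopology.SingularHomology
open Summit.HodgeConjecture.HodgeConjecture.Theses.HeckePrymWeil

/-! ## Glue: the chain of aimed products, the guard -/

/-- **The chain of aimed products** (induction on `j ≥ 1` from the seed surface by the aimed step):
for every `j ≥ 1` a complex abelian `2j`-fold `(P, ψ)`, `ψ ≫ ψ = -p`, with a non-zero rational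
`(j,j)` Weil class and algebraic strong Weil plane. [cite: vanGeemen1994HodgeAV, 5.3–5.4] -/
theorem seedChain {p : ℕ} (hp : p.Prime) (hp4 : p % 4 = 3) (hp7 : 7 ≤ p) :
    ∀ j : ℕ, 0 < j → ∃ (P : AbelianVariety ℂ) (ψ : P ⟶ P), P.dim = 2 * j ∧ ψ ≫ ψ = -(p • 𝟙 P) ∧
      (∃ c ∈ weilClassesOf P ψ j p, IsRationalClass c ∧ IsOfHodgeType (2 * j) P.X (2 * j) j j c ∧ c ≠ 0) ∧
      weilClassesOf P ψ j p ≤ algebraicClasses P.X j := by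
  intro j hj
  induction j with
  | zero => exact absurd hj (lt_irrefl 0)
  | succ j ih =>
    rcases Nat.eq_zero_or_pos j with rfl | hj'
    · exact stub_seedSurface p hp.pos
    · obtain ⟨P, ψ, hP, hψ, hc, halg⟩ := ih hj'
      obtain ⟨T, θ, -, -, hT, hθ, -, -, -, hTalg, hTc⟩ :=
        stub_aimedStep p hp hp4 hp7 j hj' P ψ hP hψ hc halg
      exact ⟨T, θ, hT, hθ, hTc, hTalg⟩

/-- **Hyperbolic targets with algebraic Weil classes**: for `p ≡ 3 (4)` prime `≥ 7` and every
`j ≥ 2` there is a complex abelian `2j`-fold `(T, θ)`, `θ ≫ θ = -p`, with a projective embedding `e`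
and a rational `a ≠ 0` for which `(T, θ)` is of HYPERBOLIC Weil type for the `K`-symmetrised
hyperplane class `p·e^*a + θ^*e^*a`, and whose strong Weil plane consists of algebraic classes
(the aimed step applied to the chain). [cite: Markman2025SurveySecant, §11.5 Step 2]
[cite: vanGeemen1994HodgeAV, Lemma 5.2, 5.3–5.4] -/
theorem hyperbolicTargets {p : ℕ} (hp : p.Prime) (hp4 : p % 4 = 3) (hp7 : 7 ≤ p) {j : ℕ} (hj : 2 ≤ j) :
    ∃ (T : AbelianVariety ℂ) (θ : T ⟶ T) (e : ProjectiveEmbedding T.X)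
      (a : complexBetti (projectiveSpace e.n ℂ) 2),
      T.dim = 2 * j ∧ θ ≫ θ = -(p • 𝟙 T) ∧ IsRationalClass a ∧ a ≠ 0 ∧
      IsHyperbolicWeilType T θ j
        ((p : ℂ) • complexBetti.map e.ι 2 a + complexBetti.map θ.hom.hom.hom 2 (complexBetti.map e.ι 2 a)) ∧
      weilClassesOf T θ j p ≤ algebraicClasses T.X j := by
  obtain ⟨j, rfl⟩ : ∃ j', j = j' + 1 := ⟨j - 1, by omega⟩
  obtain ⟨P, ψ, hP, hψ, hc, halg⟩ := seedChain hp hp4 hp7 j (by omega)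
  obtain ⟨T, θ, e, a, hT, hθ, ha, ha0, hhyp, hTalg, -⟩ :=
    stub_aimedStep p hp hp4 hp7 j (by omega) P ψ hP hψ hc halg
  exact ⟨T, θ, e, a, hT, hθ, ha, ha0, hhyp, hTalg⟩

/-- Two eigenvectors of one endomorphism for different eigenvalues with zero sum are zero.
[folklore] -/
theorem eq_zero_of_mem_eigenspace_of_add_eq_zero {M : Type*} [AddCommGroup M] [Module ℂ M]
    (T : Module.End ℂ M) {μ ν : ℂ} (hμν : μ ≠ ν) {u v : M} (hu : u ∈ Module.End.eigenspace T μ)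
    (hv : v ∈ Module.End.eigenspace T ν) (h : u + v = 0) : u = 0 := by
  rw [Module.End.mem_eigenspace_iff] at hu hv
  have hv' : v = -u := by rw [← sub_eq_zero, sub_neg_eq_add, add_comm, h]
  subst hv'
  rw [map_neg, smul_neg, hu, neg_inj] at hv
  have h2 : (μ - ν) • u = 0 := by rw [sub_smul, hv, sub_self]
  rcases smul_eq_zero.1 h2 with h3 | h3
  · exact absurd (sub_eq_zero.1 h3) hμν
  · exact h3

/-- `(1 + i√p)² ≠ (1 - i√p)²` for `p ≥ 1`. [folklore] -/
theorem one_add_I_mul_sqrt_sq_ne (p : ℕ) (hp : 0 < p) :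
    (1 + Complex.I * (Real.sqrt p : ℂ)) ^ (2 * 1) ≠ (1 - Complex.I * (Real.sqrt p : ℂ)) ^ (2 * 1) := by
  intro h
  have hs : (Real.sqrt p : ℂ) ≠ 0 := by
    have : (0 : ℝ) < Real.sqrt p := Real.sqrt_pos.2 (by exact_mod_cast hp)
    exact_mod_cast this.ne'
  have h4 : (4 : ℂ) * (Complex.I * (Real.sqrt p : ℂ)) = 0 := by
    linear_combination h
  simp [Complex.I_ne_zero, hs] at h4

/-- **The guard of the crux from the aimed surface**: `u₊ + u₋` (with `u± ≠ 0` in the two Weil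
lines of `(B, ψ)`) is non-zero and lies in the typed Weil span
`Eig((𝟙+ψ)^*, (1+i√p)²) ⊔ Eig((𝟙+ψ)^*, (1-i√p)²)`. [cite: vanGeemen1994HodgeAV, 4.9] -/
theorem guard_of_weilLines {p : ℕ} (hp : 0 < p) {B : AbelianVariety ℂ} {ψ : B ⟶ B}
    {up um : complexBetti B.X (2 * 1)} (hup : up ∈ weilClassesPlus B ψ 1 p)
    (hum : um ∈ weilClassesMinus B ψ 1 p) (hup0 : up ≠ 0) :
    up + um ≠ 0 ∧
      up + um ∈ Module.End.eigenspace (complexBetti.map (𝟙 B + ψ).hom.hom.hom (2 * 1)).hom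
            ((1 + Complex.I * (Real.sqrt (p : ℝ) : ℂ)) ^ (2 * 1)) ⊔
          Module.End.eigenspace (complexBetti.map (𝟙 B + ψ).hom.hom.hom (2 * 1)).hom
            ((1 - Complex.I * (Real.sqrt (p : ℝ) : ℂ)) ^ (2 * 1)) := by
  have hu := weilClassesPlus_le_eigenspace_id_add ψ 1 p hup
  have hv := weilClassesMinus_le_eigenspace_id_add ψ 1 p hum
  refine ⟨fun h ↦ hup0 (eq_zero_of_mem_eigenspace_of_add_eq_zero _ (one_add_I_mul_sqrt_sq_ne p hp)
    hu hv h), Submodule.add_mem _ (Submodule.mem_sup_left hu) (Submodule.mem_sup_right hv)⟩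

/-- **`HeckePrymAnchors` from the common core of the two shared Weil-family facts.** `hC`: for
`n, d ≥ 1`, a hyperbolic `(P, ψ₀, h_K)`, a non-zero Weil class `w` of `(P, ψ₀)` and a hyperbolic
target `(A, φ, h_K(A))` of the same `(2n, d)`: an embedded smooth projective family `f : 𝒳 → S` over
a smooth irreducible quasi-projective base, `P ≅ 𝒳_{s₀}`, all fibres `√-d`-abelian `2n`-folds, a
continuous section `σ` of `R^{2n} f_* ℂ` through `e'^{-1 *} w` of Hodge type `(n,n)` everywhere, and
a reached fibre `A' ≅ 𝒳_{s₁}`, `φ'² = -d`, with a `K`-isogeny `u : A' → A` (flat, `u ≫ v = [m]`,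
`v ≫ φ' = φ ≫ v`) and `σ(s₁)` in the Weil plane of `(A', φ')` — the conclusion of the tree's
`weilFamilyReach_core_of_weilSystem`. Proof: balanced `A` — aimed companion surface
(`exists_weilTypeSurface_prod_isHyperbolicWeilType_all_holds`), the family through the hyperbolic
`A × B` reaching the hyperbolic target of `hyperbolicTargets` whose Weil plane is algebraic, the
discharged Deligne-1968 engine globalising `σ`, rationality along `σ`, algebraicity across the
isogeny pair (`stub_isogenyTransfer`) and the chart (`owf_isoTransport`); unbalanced `A` — only `0`
is to be anchored (`stub_unbalancedZero`, `owf_anchored_zero`).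
[cite: Deligne1982HodgeCycles, proof of Thm. 4.8 (pp. 47–52) with Prop. 4.4]
[cite: vanGeemen1994HodgeAV, Lemma 5.2, 5.3–5.4 and 5.8–5.11]
[cite: Markman2025SurveySecant, §11.5 Step 2] [cite: Deligne1968, Prop. (2.1) with (2.6.3)] -/
theorem heckePrymAnchors_of_reachCore
    (hC : ∀ (n d : ℕ), 1 ≤ n → 1 ≤ d →
      ∀ (P : AbelianVariety ℂ) (ψ₀ : P ⟶ P) (e : ProjectiveEmbedding P.X)
        (a : complexBetti (projectiveSpace e.n ℂ) 2),
        P.dim = 2 * n → ψ₀ ≫ ψ₀ = -(d • 𝟙 P) → IsRationalClass a → a ≠ 0 →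
        IsHyperbolicWeilType P ψ₀ n
          ((d : ℂ) • complexBetti.map e.ι 2 a + complexBetti.map ψ₀.hom.hom.hom 2 (complexBetti.map e.ι 2 a)) →
      ∀ w : complexBetti P.X (2 * n), w ∈ weilClassesOf P ψ₀ n d → w ≠ 0 →
      ∀ (A : AbelianVariety ℂ) (φ : A ⟶ A) (eA : ProjectiveEmbedding A.X)
        (aA : complexBetti (projectiveSpace eA.n ℂ) 2),
        A.dim = 2 * n → φ ≫ φ = -(d • 𝟙 A) → IsRationalClass aA → aA ≠ 0 →
        IsHyperbolicWeilType A φ n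
          ((d : ℂ) • complexBetti.map eA.ι 2 aA +
            complexBetti.map φ.hom.hom.hom 2 (complexBetti.map eA.ι 2 aA)) →
        ∃ (𝒳 S : SchemeOver ℂ) (f : 𝒳 ⟶ S) (s₀ s₁ : ComplexPoints S) (e' : P.X ≅ fiberOver f s₀)
          (A' : AbelianVariety ℂ) (φ' : A' ⟶ A') (e₁ : A'.X ≅ fiberOver f s₁)
          (σ : ComplexPoints S → FiberClass f (2 * n)),
          IsSmoothProjectiveFamily f (2 * n) ∧
          (∃ (N : ℕ) (ι : 𝒳 ⟶ projectiveSpace N ℂ ⊗ S),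
            IsClosedImmersion ι.left ∧ ι ≫ snd (projectiveSpace N ℂ) S = f) ∧
          IrreducibleSpace S.left ∧ AlgebraicGeometry.Smooth S.hom ∧ IsQuasiProjectiveOver S ∧
          (∀ s : ComplexPoints S, ∃ (A'' : AbelianVariety ℂ) (φ'' : A'' ⟶ A''),
            A''.dim = 2 * n ∧ φ'' ≫ φ'' = -(d • 𝟙 A'') ∧ Nonempty (A''.X ≅ fiberOver f s)) ∧
          Continuous σ ∧ (∀ s, (σ s).pt = s) ∧
          (∀ s, IsOfHodgeType (2 * n) (fiberOver f (σ s).pt) (2 * n) n n (σ s).cls) ∧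
          σ s₀ = ⟨s₀, complexBetti.map e'.inv (2 * n) w⟩ ∧
          A'.dim = 2 * n ∧ φ' ≫ φ' = -(d • 𝟙 A') ∧
          (∃ (u : A' ⟶ A) (v : A ⟶ A') (m : ℕ), 0 < m ∧ u ≫ v = m • 𝟙 A' ∧
            AlgebraicGeometry.Flat u.hom.hom.hom.left ∧ v ≫ φ' = φ ≫ v) ∧
          ∃ w₁ : complexBetti (fiberOver f s₁) (2 * n),
            σ s₁ = ⟨s₁, w₁⟩ ∧ complexBetti.map e₁.hom (2 * n) w₁ ∈ weilClassesOf A' φ' n d ∧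
              complexBetti.map e₁.hom (2 * n) w₁ ≠ 0) :
    HeckePrymAnchors := by
  intro p hp hp4 hp7 g hg n k hk hkm A φ hA hφ
  have hk3 : 3 ≤ k := owf_three_le_k hp7 hg hkm
  subst hk
  have hn : 0 < n := by omega
  have hp0 : 0 < p := hp.pos
  have hφ' : φ ≫ φ = -(p • 𝟙 A) := by rw [hφ, natCast_zsmul]
  -- the W-engine (Deligne 1968, discharged)
  have hG := stub_globalClassOfSection_of_leray deligne1968_invariantClass_fromTotalSpace_holds
  by_cases hbal : Module.finrank ℂ ↥(Module.End.eigenspace (complexBetti.map φ.hom.hom.hom 1).hom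
      (Complex.I * (Real.sqrt p : ℂ)) ⊓ hodgeOneZero (Motives.isSmoothProjective_of_dim_eq' hA)) = n
  · /- BALANCED `A`: aim the companion surface -/
    obtain ⟨c₀, hc₀0, hc₀rat, hc₀H, hc₀E⟩ := exists_isRationalClass_hodgeType_of_weilType' hn hA hp0 hφ hbal
    have hc₀W : c₀ ∈ weilClassesOf A φ n p := stub_upgrade p hp hp4 hp7 n A φ hA hφ hc₀E
    obtain ⟨B, ψ, hB, -, hψ, ⟨up, um, hup, hum, hbrat, hbH, hup0, -, -⟩, e, a, ha, ha0, hhyp⟩ :=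
      exists_weilTypeSurface_prod_isHyperbolicWeilType_all_holds n hn p hp0 A φ hA
        (Motives.isSmoothProjective_of_dim_eq' hA) hφ' ⟨c₀, hc₀rat, hc₀H, hc₀W, hc₀0⟩
    have hψℤ : ψ ≫ ψ = -((p : ℤ) • 𝟙 B) := by rw [hψ, natCast_zsmul]
    obtain ⟨hb0, hbE⟩ := guard_of_weilLines hp0 hup hum hup0
    refine ⟨B, ψ, by omega, hψℤ, ⟨up + um, hb0, hbrat, hbH, hbE⟩, ?_⟩
    intro c hrat hH hW
    -- the product `X = A × B` with `Φ = φ × ψ`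
    have hX : (A.prod B).dim = 2 * (n + 1) := by rw [AbelianVariety.dim_prod, hA, hB]; ring
    have hΦ' := prodLift_comp_self_eq_neg_nsmul hφ' hψ
    have hΦ : AbelianVariety.prodLift (AbelianVariety.fst A B ≫ φ) (AbelianVariety.snd A B ≫ ψ) ≫
        AbelianVariety.prodLift (AbelianVariety.fst A B ≫ φ) (AbelianVariety.snd A B ≫ ψ) =
        -((p : ℤ) • 𝟙 (A.prod B)) := by rw [hΦ', natCast_zsmul]
    -- the zero class: constant family
    by_cases h0 : c = 0
    · subst h0
      exact owf_anchored_zero p (n + 1) (A.prod B) _ hX hΦ ⟨hH.choose⟩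
    -- typing upgrade; the hyperbolic algebraic target; the family through `A × B` reaching it
    have hcW := stub_upgrade p hp hp4 hp7 (n + 1) (A.prod B) _ hX hΦ hW
    obtain ⟨T, θ, eT, aT, hT, hθ, haT, haT0, hhypT, hTalg⟩ := hyperbolicTargets hp hp4 hp7 (j := n + 1) (by omega)
    obtain ⟨𝒳, S, f, s₀, s₁, e', A', φ', e₁, σ, hfam, hemb, hirr, hsm, hSqp, hfib, hσ, hpt,
        hHσ, hs₀, hA', hφ'A, ⟨u, v, m, hm, huv, hu, hv⟩, w₁, hs₁, hw₁W, -⟩ :=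
      hC (n + 1) p (by omega) hp.one_le (A.prod B) _ e a hX hΦ' ha ha0 hhyp c hcW h0 T θ eT aT hT hθ
        haT haT0 hhypT
    -- the global class of the flat section (W-engine)
    obtain ⟨W, hWσ⟩ := hG f (2 * (n + 1)) (2 * (n + 1)) hfam hemb hsm hSqp hirr σ hσ hpt
    have hcls : ∀ (s : ComplexPoints S) (y : complexBetti (fiberOver f s) (2 * (n + 1))),
        σ s = ⟨s, y⟩ → complexBetti.map (fiberι f s) (2 * (n + 1)) W = y := by
      intro s y hy
      have h := (hWσ s).symm.trans hy
      simp only [globalSection, FiberClass.mk.injEq, heq_eq_eq, true_and] at h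
      exact h
    have hW₀ : complexBetti.map (fiberι f s₀) (2 * (n + 1)) W = complexBetti.map e'.inv (2 * (n + 1)) c :=
      hcls s₀ _ hs₀
    have hW₁ : complexBetti.map (fiberι f s₁) (2 * (n + 1)) W = w₁ := hcls s₁ w₁ hs₁
    -- rationality along the section (proved), Hodge type from the family
    have hrat₀ : IsRationalClass (σ s₀).cls := by
      rw [hs₀]; exact hrat.map _
    have hratσ : ∀ s, IsRationalClass (σ s).cls :=
      stub_rationalAlongSection f (2 * (n + 1)) (2 * (n + 1)) hfam hsm hSqp hirr σ hσ hpt s₀ hrat₀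
    have hfibre : ∀ s : ComplexPoints S,
        IsRationalClass (complexBetti.map (fiberι f s) (2 * (n + 1)) W) ∧
        IsOfHodgeType (2 * (n + 1)) (fiberOver f s) (2 * (n + 1)) (n + 1) (n + 1)
          (complexBetti.map (fiberι f s) (2 * (n + 1)) W) := by
      intro s
      have h₁ := hratσ s
      have h₂ := hHσ s
      rw [hWσ s] at h₁ h₂
      exact ⟨h₁, h₂⟩
    have hfib' : ∀ s : ComplexPoints S, ∃ (A'' : AbelianVariety ℂ) (φ'' : A'' ⟶ A''),
        A''.dim = 2 * (n + 1) ∧ φ'' ≫ φ'' = -((p : ℤ) • 𝟙 A'') ∧ Nonempty (A''.X ≅ fiberOver f s) := by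
      intro s
      obtain ⟨A'', φ'', h₁, h₂, h₃⟩ := hfib s
      exact ⟨A'', φ'', h₁, by rw [h₂, natCast_zsmul], h₃⟩
    -- algebraicity at the reached fibre: target ⇒ (isogeny pair) `A'` ⇒ (chart) `𝒳_{s₁}`
    have hφ'ℤ : φ' ≫ φ' = -((p : ℤ) • 𝟙 A') := by rw [hφ'A, natCast_zsmul]
    have hA'alg : weilClassesOf A' φ' (n + 1) p ≤ algebraicClasses A'.X (n + 1) :=
      stub_isogenyTransfer p (n + 1) A' T φ' θ hA' hT hφ'ℤ u v m hm huv hu hv hTalg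
    -- assemble the anchoring
    refine ⟨𝒳, S, f, s₀, s₁, e', W, hfam, hirr, hsm, hfibre, hfib', ?_, ?_⟩
    · rw [hW₀, ← CategoryTheory.comp_apply, ← complexBetti.map_comp, Iso.hom_inv_id, complexBetti.map_id]
      rfl
    · rw [hW₁]
      exact owf_isoTransport _ A' e₁ (n + 1) w₁ (hA'alg hw₁W)
  · /- UNBALANCED `A`: only the zero class is to be anchored -/
    obtain ⟨B, ψ, hB, hψ, b, hb0, hbrat, hbH, hbE⟩ := stub_weilSurface p hp hp4 hp7
    refine ⟨B, ψ, hB, hψ, ⟨b, hb0, hbrat, hbH, hbE⟩, ?_⟩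
    intro c hrat hH hW
    have hB' : B.dim = 2 * 1 := by omega
    have hψ' : ψ ≫ ψ = -(p • 𝟙 B) := by rw [hψ, natCast_zsmul]
    have hX : (A.prod B).dim = 2 * (n + 1) := by rw [AbelianVariety.dim_prod, hA, hB]; ring
    have hΦ' := prodLift_comp_self_eq_neg_nsmul hφ' hψ'
    have hΦ : AbelianVariety.prodLift (AbelianVariety.fst A B ≫ φ) (AbelianVariety.snd A B ≫ ψ) ≫
        AbelianVariety.prodLift (AbelianVariety.fst A B ≫ φ) (AbelianVariety.snd A B ≫ ψ) =
        -((p : ℤ) • 𝟙 (A.prod B)) := by rw [hΦ', natCast_zsmul]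
    have hbW : b ∈ weilClassesOf B ψ 1 p := stub_upgrade p hp hp4 hp7 1 B ψ hB' hψ hbE
    have hcW := stub_upgrade p hp hp4 hp7 (n + 1) (A.prod B) _ hX hΦ hW
    have h0 : c = 0 :=
      stub_unbalancedZero p hp0 n hn A φ B ψ hA hB' hφ' hψ' ⟨b, hbW, hb0, hbH⟩ hbal c hcW hH
    subst h0
    exact owf_anchored_zero p (n + 1) (A.prod B) _ hX hΦ ⟨hH.choose⟩

/-- **The core from `weilFamilyReach_hyperbolic`**: forget the polarization class `H` and the
non-vanishing, and flip the reaching isogeny pair (`u : A → A'`, `v ≫ φ = φ' ≫ v` becomes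
`u' : A' → A` flat with `v' ≫ φ' = φ ≫ v'`, `Motives.AbelianVariety.exists_isogenyPair_flip`:
`dim A = 2n = dim A'`, characteristic `0`). [cite: Deligne1982HodgeCycles, proof of Thm. 4.8 (pp. 47–52)]
[cite: MumfordAV1970, §19 Remark p. 169] -/
theorem reachCore_of_weilFamilyReach (hR : weilFamilyReach_hyperbolic) :
    ∀ (n d : ℕ), 1 ≤ n → 1 ≤ d →
      ∀ (P : AbelianVariety ℂ) (ψ₀ : P ⟶ P) (e : ProjectiveEmbedding P.X)
        (a : complexBetti (projectiveSpace e.n ℂ) 2),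
        P.dim = 2 * n → ψ₀ ≫ ψ₀ = -(d • 𝟙 P) → IsRationalClass a → a ≠ 0 →
        IsHyperbolicWeilType P ψ₀ n
          ((d : ℂ) • complexBetti.map e.ι 2 a + complexBetti.map ψ₀.hom.hom.hom 2 (complexBetti.map e.ι 2 a)) →
      ∀ w : complexBetti P.X (2 * n), w ∈ weilClassesOf P ψ₀ n d → w ≠ 0 →
      ∀ (A : AbelianVariety ℂ) (φ : A ⟶ A) (eA : ProjectiveEmbedding A.X)
        (aA : complexBetti (projectiveSpace eA.n ℂ) 2),
        A.dim = 2 * n → φ ≫ φ = -(d • 𝟙 A) → IsRationalClass aA → aA ≠ 0 →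
        IsHyperbolicWeilType A φ n
          ((d : ℂ) • complexBetti.map eA.ι 2 aA +
            complexBetti.map φ.hom.hom.hom 2 (complexBetti.map eA.ι 2 aA)) →
        ∃ (𝒳 S : SchemeOver ℂ) (f : 𝒳 ⟶ S) (s₀ s₁ : ComplexPoints S) (e' : P.X ≅ fiberOver f s₀)
          (A' : AbelianVariety ℂ) (φ' : A' ⟶ A') (e₁ : A'.X ≅ fiberOver f s₁)
          (σ : ComplexPoints S → FiberClass f (2 * n)),
          IsSmoothProjectiveFamily f (2 * n) ∧
          (∃ (N : ℕ) (ι : 𝒳 ⟶ projectiveSpace N ℂ ⊗ S),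
            IsClosedImmersion ι.left ∧ ι ≫ snd (projectiveSpace N ℂ) S = f) ∧
          IrreducibleSpace S.left ∧ AlgebraicGeometry.Smooth S.hom ∧ IsQuasiProjectiveOver S ∧
          (∀ s : ComplexPoints S, ∃ (A'' : AbelianVariety ℂ) (φ'' : A'' ⟶ A''),
            A''.dim = 2 * n ∧ φ'' ≫ φ'' = -(d • 𝟙 A'') ∧ Nonempty (A''.X ≅ fiberOver f s)) ∧
          Continuous σ ∧ (∀ s, (σ s).pt = s) ∧
          (∀ s, IsOfHodgeType (2 * n) (fiberOver f (σ s).pt) (2 * n) n n (σ s).cls) ∧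
          σ s₀ = ⟨s₀, complexBetti.map e'.inv (2 * n) w⟩ ∧
          A'.dim = 2 * n ∧ φ' ≫ φ' = -(d • 𝟙 A') ∧
          (∃ (u : A' ⟶ A) (v : A ⟶ A') (m : ℕ), 0 < m ∧ u ≫ v = m • 𝟙 A' ∧
            AlgebraicGeometry.Flat u.hom.hom.hom.left ∧ v ≫ φ' = φ ≫ v) ∧
          ∃ w₁ : complexBetti (fiberOver f s₁) (2 * n),
            σ s₁ = ⟨s₁, w₁⟩ ∧ complexBetti.map e₁.hom (2 * n) w₁ ∈ weilClassesOf A' φ' n d ∧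
              complexBetti.map e₁.hom (2 * n) w₁ ≠ 0 := by
  intro n d hn hd P ψ₀ e a hP hψ ha ha0 hhyp w hw hw0 A φ eA aA hA hφ haA haA0 hhypA
  obtain ⟨𝒳, S, f, s₀, s₁, e', A', φ', e₁, σ, H, hfam, hemb, hirr, hsm, hqp, hfib, -, -, hσ, hpt, hHσ,
      hs₀, hA', hφ', ⟨u, v, m, hm, huv, -, hv⟩, w₁, hs₁, hw₁W, hw₁0⟩ :=
    hR n d hn hd P ψ₀ e a hP hψ ha ha0 hhyp w hw hw0 A φ eA aA hA hφ haA haA0 hhypA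
  obtain ⟨u', v', m', hm', hu'v', -, -, -, hflat, hv'φ, -⟩ :=
    AbelianVariety.exists_isogenyPair_flip hm huv (hA.trans hA'.symm) hv
  exact ⟨𝒳, S, f, s₀, s₁, e', A', φ', e₁, σ, hfam, hemb, hirr, hsm, hqp, hfib, hσ, hpt, hHσ, hs₀, hA',
    hφ', ⟨u', v', m', hm', hu'v', hflat, hv'φ⟩, w₁, hs₁, hw₁W, hw₁0⟩

/-- **`HeckePrymAnchors` from the shared Weil-family fact** (CONDITIONAL result):
`weilFamilyReach_hyperbolic → HeckePrymAnchors` — the summit's shared fact (Deligne's polarized Weil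
family through a hyperbolic abelian `2n`-fold with reach of every hyperbolic target up to
`K`-isogeny; also the residual fact of stmt-HodgeConjecture-1333's line and of
`HeckePrymWeilWeilTwelvefoldsSqrtMinus7IsotypicReach`) implies the crux, by
`heckePrymAnchors_of_reachCore ∘ reachCore_of_weilFamilyReach`.
[cite: Deligne1982HodgeCycles, proof of Thm. 4.8 (pp. 47–52) with Prop. 4.4]
[cite: vanGeemen1994HodgeAV, Lemma 5.2, 5.3–5.4 and 5.8–5.11] [cite: Markman2025SurveySecant, §11.5 Step 2] -/
theorem heckePrymAnchors_of_weilFamilyReach :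
    (weilFamilyReach_hyperbolic) → Summit.HodgeConjecture.HodgeConjecture.Theses.HeckePrymWeil.HeckePrymAnchors :=
  fun hR ↦ heckePrymAnchors_of_reachCore (reachCore_of_weilFamilyReach hR)

/-- **`HeckePrymAnchors` from the family-first sibling fact** (CONDITIONAL result):
`weilFamily_hyperbolic_weilSystem_reach → HeckePrymAnchors`, by `heckePrymAnchors_of_reachCore ∘
weilFamilyReach_core_of_weilSystem` (the tree's bookkeeping `HodgeTheory/WeilFamilyReachOfSystem`).
So the crux is closed modulo EITHER of the two shared renderings of Deligne's family (and, since
v16, modulo the bespoke `deligne1982_weilFamily_levelStructure`).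
[cite: Deligne1982HodgeCycles, proof of Thm. 4.8 (pp. 47–52) with Prop. 4.4]
[cite: vanGeemen1994HodgeAV, Lemma 5.2, 5.3–5.4 and 5.8–5.11] -/
theorem heckePrymAnchors_of_weilSystem :
    (weilFamily_hyperbolic_weilSystem_reach) → Summit.HodgeConjecture.HodgeConjecture.Theses.HeckePrymWeil.HeckePrymAnchors :=
  fun hS ↦ heckePrymAnchors_of_reachCore (weilFamilyReach_core_of_weilSystem hS)

end Summit.HodgeConjecture.HodgeConjecture.Theorems.HeckePrymWeilLine

end
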